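import Summits.ResolutionOfSingularities.ResolutionOfSingularities.Theorems.EquisingularLiftEquisingularLiftNatNodalCurveLiftDefs
import Summits.ResolutionOfSingularities.ResolutionOfSingularities.Theorems.EquisingularLiftEquisingularLiftNatNodalHostedRoundDefs
import Summits.ResolutionOfSingularities.ResolutionOfSingularities.Theorems.EquisingularLiftEquisingularLiftNatHostedRoundKeep
import Summits.ResolutionOfSingularities.ResolutionOfSingularities.Theorems.EquisingularLiftEquisingularLiftNatCrossedLetterNodal
import Summits.ResolutionOfSingularities.ResolutionOfSingularities.Theorems.EquisingularLiftEquisingularLiftNatStalkDimension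
import Summits.ResolutionOfSingularities.ResolutionOfSingularities.Theorems.EquisingularLiftEquisingularLiftNatCentreCodimTwo
import Summits.ResolutionOfSingularities.ResolutionOfSingularities.Theorems.EquisingularLiftEquisingularLiftNatModelStep
import Mathlib.AlgebraicGeometry.FunctionField
import Mathlib.RingTheory.KrullDimension.Regular
import HarnessLib

/-!
# [OURS · L1 W4.5(b) · EL♮(3) · WIDTH TABLE D8 «NODAL HOSTED ROUND (HR-KEEP-N)», support debt S-D8-LIFT, part 4 (B)] THE NODAL HOSTED ROUND FROM THE
# DOOR-REGIME NODAL LIFT: `nodalHostedRoundFact_of_nodalCurveLiftFact : NodalCurveLiftFact → NodalHostedRoundFact`, with (D2) READ OFF by T-DIM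

res-L1-w45b-stub-4 g14 (desk R69 (iii) / DESK WORD g25-19; split of record STATUS 2026-08-29T04:20:51Z).  OURS; NOT a statement of any manuscript
([Hironaka2017] is a candidate under adjudication, nothing of it is asserted); AI-written, weaker than expert review.  No `sorry`; standard axioms;
DEF-FREE; ONE named-fact hypothesis `hF : NodalCurveLiftFact` (the door-regime nodal residue (T-k)-N₂, …NatNodalCurveLiftDefs).
`--supports stmt-ResolutionOfSingularities-20148 --as helper`.

WHAT.
* `withBot_enat_cancel_one_one` — `a + 1 + 1 = d + 1 + 1 ⇒ a = d` in `WithBot ℕ∞` (arithmetic).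
* ★ `ringKrullDim_redSub_stalk_eq_two_of_letter` — (D2) READ OFF: on a `Ch`-stage `X′` of the chain over the smooth proper `P/O` of relative
  dimension 3 (`Chain P Y X′ σ′ S′`) with model square `(j, t)`, for a LETTER's model `𝓔` (principal stalks, `𝓔 ≠ ⊥`, `O`-flat) with reduced trace
  `𝓔·𝒪_{F₁} = 𝓘⟨E⟩`, the reduced surface `Ẽ = redSub F₁ E` has `dim 𝒪_{Ẽ,z} = 2` at every closed point `z`.  Proof: `x = j z` is closed and special,
  so `dim 𝒪_{X′,x} = 3 + 1` (T-DIM ✓ `ringKrullDim_stalk_eq_succ_of_chain`); `𝓔_x = (g)` with `0 ≠ g ∈ 𝔪_x` (✓ `stalkIdeal_ne_bot_of_ne_bot`), so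
  `dim 𝒪_{X′,x}/𝓔_x + 1 = dim 𝒪_{X′,x}` (Mathlib `ringKrullDim_quotient_span_singleton_succ_eq_ringKrullDim_of_mem_nonZeroDivisors`); and
  `dim 𝒪_{X′,x}/𝓔_x = dim 𝒪_{Ẽ,z} + 1` (stub-3's flat dimension formula ✓ `ringKrullDim_quotient_stalkIdeal_eq_of_model`).
* ★ `nodalHostedRoundFact_of_nodalCurveLiftFact (hF : NodalCurveLiftFact) : NodalHostedRoundFact` — ✓ `nodalHostedRoundFact_of_nodalEmbeddedCurveLiftFact`'s
  composition (p695152: `hround_keep` with the (T-k) call fed (N1)/(N4) and the members by ✓ (CL)-N `TCPlus.crossedLetter_clausesN`) with the (T-k)-N₂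
  call ALSO fed (D1) = the round's own `hZdim` and (D2) = `ringKrullDim_redSub_stalk_eq_two_of_letter` at the host letter `E₁`.
[cite: Matsumura1987, Thm. 15.1 (flat dimension formula), Thm. 13.5] [folklore; pure composition otherwise]
-/

set_option linter.dupNamespace false -- mandated namespace `Summit.<Summit>.<Problem>` of this single-conjunct summit
set_option linter.overlappingInstances false -- signatures carry `[IsDomain O] [IsDiscreteValuationRing O]`

noncomputable section

open CategoryTheory CategoryTheory.Limits AlgebraicGeometry TopologicalSpace Topology IsLocalRing
open Literature.AlgebraicGeometry.Resolution
open AlgebraicGeometry.Scheme.IdealSheafData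
open Summit.ResolutionOfSingularities.ResolutionOfSingularities.Theses.EquisingularLift.Split
open Summit.ResolutionOfSingularities.ResolutionOfSingularities.Cruxes.EquisingularLift.StrataSplit

namespace Summit.ResolutionOfSingularities.ResolutionOfSingularities.Cruxes.EquisingularLiftNat.Sections

/-! ## Arithmetic in `WithBot ℕ∞` -/

/-- Cancellation in `WithBot ℕ∞`: `a + 1 + 1 = d + 1 + 1 ⇒ a = d` for natural `d`. [elementary] -/
theorem withBot_enat_cancel_one_one {a : WithBot ℕ∞} {d : ℕ} (h : a + 1 + 1 = ((d + 1 + 1 : ℕ) : WithBot ℕ∞)) :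
    a = (d : WithBot ℕ∞) := by
  induction a using WithBot.recBotCoe with
  | bot =>
    exfalso
    rw [WithBot.bot_add, WithBot.bot_add, ← WithBot.coe_natCast] at h
    exact WithBot.bot_ne_coe h
  | coe b =>
    have h2 : ((b : WithBot ℕ∞) + 1 + 1) = ((b + 1 + 1 : ℕ∞) : WithBot ℕ∞) := by push_cast; rfl
    rw [h2, ← WithBot.coe_natCast, WithBot.coe_inj] at h
    rw [← WithBot.coe_natCast]
    congr 1
    induction b using ENat.recTopCoe with
    | top =>
      exfalso
      rw [top_add, top_add] at h
      exact (ENat.top_ne_coe _ h).elim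
    | coe m =>
      have h' : ((m + 1 + 1 : ℕ) : ℕ∞) = ((d + 1 + 1 : ℕ) : ℕ∞) := by
        push_cast at h ⊢; exact h
      have := Nat.cast_injective (R := ℕ∞) h'
      have hm : m = d := by omega
      subst hm; rfl

/-! ## (D2) read off by T-DIM: the reduced special fibre of a letter is a surface -/

/-- ★ **(D2) READ OFF.**  On a `Ch`-stage `X′` of the chain (`Chain P Y X′ σ′ S′`, `P/O` smooth proper of relative dimension 3, `Y` with a generic point
`ξ`) with model square `(j, t)` over `θ`, let `𝓔` be a letter's model: principal stalk ideals, `𝓔 ≠ ⊥`, `V(𝓔)` flat over `O`, reduced trace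
`𝓔·𝒪_{F₁} = 𝓘⟨E⟩`.  Then the reduced surface `Ẽ = redSub F₁ E` has two-dimensional local rings at its closed points: `dim 𝒪_{X′,j z} = 4` (T-DIM),
`dim 𝒪_{X′,j z}/𝓔 = 3` (principal non-zero stalk in a domain), `dim 𝒪_{X′,j z}/𝓔 = dim 𝒪_{Ẽ,z} + 1` (flat dimension formula).
[cite: Matsumura1987, Thm. 15.1, Thm. 13.5] [OURS · L1 W4.5b · WIDTH TABLE D8, support debt S-D8-LIFT, part 4 (B)] -/
theorem ringKrullDim_redSub_stalk_eq_two_of_letter (O : Type) [CommRing O] [IsDomain O] [IsDiscreteValuationRing O] (k : Type) [Field k]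
    (θ : O →+* k) (hθ : Function.Surjective θ) {P : Scheme.{0}} [IsIntegral P] (q : P ⟶ Spec (.of O)) [SmoothOfRelativeDimension 3 q]
    {Y : Set P} {ξ : P} (hξ : IsGenericPoint ξ Y) {X' : Scheme.{0}} {σ' : X' ⟶ P} {S' : Set X'} (hch : Chain P Y X' σ' S')
    [IsIntegral X'] [IsLocallyNoetherian X'] {F₁ : Scheme.{0}} (j : F₁ ⟶ X') (t : F₁ ⟶ Spec (.of k))
    (hsq : IsPullback j t (σ' ≫ q) (Spec.map (CommRingCat.ofHom θ)))
    (𝓔 : X'.IdealSheafData) (hEpr : ∀ x : X', (stalkIdeal 𝓔 x).IsPrincipal) (h𝓔0 : 𝓔 ≠ ⊥) [Flat (𝓔.subschemeι ≫ σ' ≫ q)]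
    {E : Set F₁} (hE : IsClosed E) (hEtr : 𝓔.comap j = vanishingIdeal (⟨E, hE⟩ : Closeds F₁)) :
    ∀ z : ↥(redSub F₁ E hE), IsClosed ({z} : Set ↥(redSub F₁ E hE)) →
      ringKrullDim ((redSub F₁ E hE).presheaf.stalk z) = ((2 : ℕ) : WithBot ℕ∞) := by
  intro z hz
  haveI : IsClosedImmersion (Spec.map (CommRingCat.ofHom θ)) := IsClosedImmersion.spec_of_surjective _ hθ
  haveI : IsClosedImmersion j := MorphismProperty.IsStableUnderBaseChange.of_isPullback hsq.flip inferInstance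
  -- the point `x = j (ι z)`: closed, special, in the support of `𝓔`
  set x : X' := j (redSubι F₁ E hE z) with hx
  have hxcl : IsClosed ({x} : Set X') := by
    have h1 := (j.isClosedEmbedding.isClosedMap) _ (((redSubι F₁ E hE).isClosedEmbedding.isClosedMap) _ hz)
    rwa [Set.image_singleton, Set.image_singleton] at h1
  have hxsp : (σ' ≫ q).base x = closedPoint O := by
    have h1 : x ∈ Set.range j := ⟨_, rfl⟩
    rw [range_eq_preimage_of_isPullback hsq, range_specMap_of_surjective_of_field θ hθ] at h1
    exact h1
  have hxsupp : x ∈ (𝓔.support : Set X') := by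
    have h1 : redSubι F₁ E hE z ∈ ((𝓔.comap j).support : Set F₁) := by
      rw [hEtr, ← Scheme.IdealSheafData.range_subschemeι]; exact ⟨z, rfl⟩
    rw [Scheme.IdealSheafData.support_comap] at h1
    exact h1
  -- `dim 𝒪_{X′,x} = 3 + 1`
  have hdimX : ringKrullDim (X'.presheaf.stalk x) = ((3 + 1 : ℕ) : WithBot ℕ∞) := ringKrullDim_stalk_eq_succ_of_chain q 3 hξ hch hxcl hxsp
  -- `𝓔_x = (g)`, `0 ≠ g ∈ 𝔪_x`, so `dim 𝒪_{X′,x}/𝓔_x + 1 = dim 𝒪_{X′,x}`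
  obtain ⟨g, hg⟩ := hEpr x
  have hg0 : g ≠ 0 := by
    intro h
    apply stalkIdeal_ne_bot_of_ne_bot h𝓔0 x
    rw [hg, h, Ideal.submodule_span_eq, Ideal.span_singleton_eq_bot]
  have hgm : g ∈ maximalIdeal (X'.presheaf.stalk x) := by
    have hle := (mem_support_iff_stalkIdeal_le _ _).mp hxsupp
    exact hle (by rw [hg, Ideal.submodule_span_eq]; exact Ideal.mem_span_singleton_self g)
  have hquot : ringKrullDim (X'.presheaf.stalk x ⧸ stalkIdeal 𝓔 x) + 1 = ringKrullDim (X'.presheaf.stalk x) := by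
    rw [hg, Ideal.submodule_span_eq]
    exact ringKrullDim_quotient_span_singleton_succ_eq_ringKrullDim_of_mem_nonZeroDivisors (mem_nonZeroDivisors_of_ne_zero hg0) hgm
  -- `dim 𝒪_{X′,x}/𝓔_x = dim 𝒪_{Ẽ,z} + 1`
  have hmodel := ringKrullDim_quotient_stalkIdeal_eq_of_model O k θ hθ (σ' ≫ q) j t hsq 𝓔 hEtr z
  rw [hmodel, hdimX] at hquot
  exact withBot_enat_cancel_one_one hquot

/-! ## The nodal hosted round from the door-regime residue -/

/-- ★ **S-D8-LIFT REDUCED TO THE DOOR-REGIME NODAL LIFT: `NodalCurveLiftFact → NodalHostedRoundFact`.**  As ✓ `nodalHostedRoundFact_of_nodalEmbeddedCurveLiftFact`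
(p695152), with the (T-k)-N₂ call ALSO fed (D1) = the round's `hZdim` and (D2) = `ringKrullDim_redSub_stalk_eq_two_of_letter` at the host letter `E₁`
(its model `𝓔` has principal stalks, is `≠ ⊥` and `O`-flat by `TCPlus.LetterDatum` and the chain's fibre over the generic point of `Y`).
[folklore; pure composition] [OURS · L1 W4.5b · WIDTH TABLE D8, support debt S-D8-LIFT, part 4 (B)] -/
theorem nodalHostedRoundFact_of_nodalCurveLiftFact (hF : NodalCurveLiftFact) : NodalHostedRoundFact := by
  intro k _ _ O _ _ _ _ _ θ hθ P q Y Ch hChStep hChSplit hYsp hYirr hYcl hPint hPnoeth hPreg hqprop hqsm X' σ' S' hCh' hX'int hX'noeth hX'reg hX'dom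
    F₁ hF₁ j t hsq T₁ hT₁cl hT₁irr hjT₁ Ls hLs E₁ Z hZ F₃ υ' hE₁ hZE hZT hTZ hZfin hEreg hunobs hN4 hZdim hOthers hυ'
  classical
  haveI := hPint; haveI := hPnoeth; haveI := hX'int; haveI := hX'noeth; haveI := hF₁; haveI := hqprop; haveI := hqsm
  obtain ⟨𝓔, hEtr, hEpr, hEreg', hEoff, hEfl⟩ := hLs E₁ hE₁
  -- properness of the stage over `O` (for (T-k)-N₂'s properness input)
  have hch : Chain P Y X' σ' S' := hChSplit _ _ _ hCh'
  obtain ⟨-, -, hσ'prop⟩ := chain_isRegular P Y X' σ' S' hch hPnoeth hPreg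
  haveI := hσ'prop
  have hEprop : IsProper (𝓔.subschemeι ≫ σ' ≫ q) := inferInstance
  -- the host's model is not `⊥`: (l-iv) and the fibre of the chain over the generic point of `Y`
  obtain ⟨ξ, hξ⟩ : ∃ ξ : P, IsGenericPoint ξ Y := QuasiSober.sober hYirr hYcl
  have h𝓔0 : 𝓔 ≠ ⊥ := by
    obtain ⟨ξ', hfib', -⟩ := Chain.fibre hch hξ
    intro h0
    have hmem : ξ' ∈ (𝓔.support : Set X') := by rw [h0, Scheme.IdealSheafData.support_bot]; trivial
    have hgen : σ' ξ' = ξ := by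
      have : ξ' ∈ σ' ⁻¹' {ξ} := by rw [hfib']; exact Set.mem_singleton ξ'
      exact this
    exact hEoff ⟨ξ', hmem, rfl⟩ (hgen ▸ hξ)
  -- (D2) for the host `Ẽ₁ = redSub F₁ (closure E₁)`, at the images of the closed points of `Z̃`
  haveI : IsClosedImmersion (Spec.map (CommRingCat.ofHom θ)) := IsClosedImmersion.spec_of_surjective _ hθ
  haveI hjci : IsClosedImmersion j := MorphismProperty.IsStableUnderBaseChange.of_isPullback hsq.flip inferInstance
  haveI : IsLocallyNoetherian F₁ := LocallyOfFiniteType.isLocallyNoetherian j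
  haveI : Flat (𝓔.subschemeι ≫ σ' ≫ q) := hEfl
  have hEdim : ∀ (i : redSub F₁ Z hZ ⟶ redSub F₁ (closure E₁) isClosed_closure),
      i ≫ redSubι F₁ (closure E₁) isClosed_closure = redSubι F₁ Z hZ →
      ∀ z : ↥(redSub F₁ Z hZ), IsClosed ({z} : Set ↥(redSub F₁ Z hZ)) →
        ringKrullDim ((redSub F₁ (closure E₁) isClosed_closure).presheaf.stalk (i z)) = ((2 : ℕ) : WithBot ℕ∞) := by
    intro i hi z hz
    refine ringKrullDim_redSub_stalk_eq_two_of_letter O k θ hθ q hξ hch j t hsq 𝓔 hEpr h𝓔0 isClosed_closure hEtr (i z) ?_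
    -- `{i z}` is closed in `Ẽ₁`: its image `ι_Z z` is closed in `F₁`
    have hzF : IsClosed ({(redSubι F₁ Z hZ) z} : Set F₁) := by
      have h1 := ((redSubι F₁ Z hZ).isClosedEmbedding.isClosedMap) _ hz
      rwa [Set.image_singleton] at h1
    have h1 : ({i z} : Set ↥(redSub F₁ (closure E₁) isClosed_closure)) =
        (redSubι F₁ (closure E₁) isClosed_closure) ⁻¹' {(redSubι F₁ Z hZ) z} := by
      ext s'
      simp only [Set.mem_singleton_iff, Set.mem_preimage]
      constructor
      · intro h; rw [h, ← Scheme.Hom.comp_apply, hi]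
      · intro h
        apply (redSubι F₁ (closure E₁) isClosed_closure).isClosedEmbedding.injective
        rw [h, ← Scheme.Hom.comp_apply, hi]
    rw [h1]; exact hzF.preimage (redSubι F₁ (closure E₁) isClosed_closure).continuous
  -- (T-k)-N₂ AT THE HOST'S MODEL: the centre `C ⊇ 𝓔`, kept in hand — fed (N1), (D1), (D2), (N4)
  obtain ⟨C, hEC, hCreg, hCfl, hCj, -⟩ := hF k O θ hθ P q X' σ' 𝓔 hX'int hX'noeth hX'reg hEreg' hEfl hEprop F₁ j t hsq (closure E₁)
    isClosed_closure hEtr Z hZ hZE hZfin hZdim hEdim hEreg hunobs hN4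
  have hC0 : C ≠ ⊥ := fun h => h𝓔0 (le_bot_iff.mp (h ▸ hEC))
  -- E1-legality of `C` upstairs: off the generic point of `Y`
  have hoff : σ' '' (C.support : Set X') ⊆ {y : P | ¬ IsGenericPoint y Y} :=
    image_support_subset_not_isGenericPoint_of_chain θ hθ q Y hYsp σ' S' hch j t hsq T₁ hjT₁ C Z hZ hCj hTZ
  -- the blow-up of `C`, its `Ch`-stage and the model square for `υ'`
  have hDT : (((vanishingIdeal (⟨Z, hZ⟩ : Closeds F₁)) : F₁.IdealSheafData).support : Set F₁) ⊆ T₁ := by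
    rw [Scheme.IdealSheafData.coe_support_vanishingIdeal]; exact hZT
  have hTD : ¬ T₁ ⊆ (((vanishingIdeal (⟨Z, hZ⟩ : Closeds F₁)) : F₁.IdealSheafData).support : Set F₁) := by
    rw [Scheme.IdealSheafData.coe_support_vanishingIdeal]; exact hTZ
  obtain ⟨X₃, τ₃, hτ₃⟩ := exists_isBlowup X' C
  obtain ⟨hX₃i, hX₃n, hX₃r, hX₃dom, hF₃i, hirr₃, j₃, t₃, hsq₃, hcomm₃, hCh₃⟩ :=
    modelStep_chain O k θ hθ P q Y hYirr hYcl Ch hChSplit hChStep X' σ' S' hCh' hX'reg hX'dom F₁ j t hsq T₁ hjT₁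
      C (vanishingIdeal (⟨Z, hZ⟩ : Closeds F₁)) hCj hCreg hCfl hoff hDT hTD X₃ τ₃ hτ₃ F₃ υ' hυ'
  rw [Scheme.IdealSheafData.coe_support_vanishingIdeal] at hirr₃ hCh₃
  haveI := hX₃n; haveI := hX₃i; haveI := hF₃i
  haveI hj₃ci : IsClosedImmersion j₃ := MorphismProperty.IsStableUnderBaseChange.of_isPullback hsq₃.flip inferInstance
  haveI : IsLocallyNoetherian F₃ := LocallyOfFiniteType.isLocallyNoetherian j₃
  -- the 2-frames of `C` (the curve clause and `n = 3`)
  have hfr : ∀ x ∈ C.support, ∃ c : Fin 2 → X'.presheaf.stalk x, Ideal.span (Set.range c) = stalkIdeal C x ∧ IsQuasiRegular c :=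
    hFrame_of_ringKrullDim_redSub O k θ hθ P q Y hYirr hYcl hPnoeth hPreg Ch hChSplit T₁ Z hZ hZdim X' σ' S' j t C hCh' hX'int hX'noeth
      hX'reg hX'dom hsq hjT₁ hCj hCfl hCreg
  -- the host letter of the strict transform (HT2′)
  have hL₉ : TCPlus.LetterDatum O P q Y F₃ X₃ (τ₃ ≫ σ') j₃ (closure (υ' ⁻¹' (closure E₁ \ Z))) :=
    TCPlus.letterDatum_transport_hostedRound' O k θ hθ q Y σ' hX'reg j t hsq isClosed_closure 𝓔 hEtr hEpr hEreg' hEoff hEfl h𝓔0 C hEC hZ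
      hCj hCfl hCreg hfr hτ₃ hυ' j₃ t₃ hsq₃ hcomm₃
  -- EVERY listed letter after the round: the host by HT2′, the others by (CL)-N (no regularity of `Z̃`)
  have hLs₃ : ∀ L ∈ Ls, TCPlus.LetterDatum O P q Y F₃ X₃ (τ₃ ≫ σ') j₃ (closure (υ' ⁻¹' (closure L \ Z))) := by
    intro L hL
    by_cases hLe : L = E₁
    · subst hLe; exact hL₉
    · obtain ⟨hc1, hc2⟩ := hOthers L hL hLe
      obtain ⟨𝓛, hl1, hl2, hl3, hl4, hl5⟩ := hLs L hL
      obtain ⟨h1, h2, h3, h4, h5⟩ := TCPlus.crossedLetter_clausesN k O θ hθ q Y σ' hX'reg hX₃r j t hsq C hZ hCj hCfl hCreg hC0 hZdim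
        hτ₃ hυ' j₃ t₃ hsq₃ hcomm₃ L 𝓛 hl1 hl2 hl3 hl4 hl5 hc1 hc2
      refine ⟨strictTransformIdeal τ₃ C 𝓛, ?_, h2, h3, h4, h5⟩
      rw [h1]
      congr 1
      exact Closeds.ext closure_closure.symm
  -- THE BIRTH of the exceptional letter (EB₀)
  have hE₃ : TCPlus.LetterDatum O P q Y F₃ X₃ (τ₃ ≫ σ') j₃ (υ' ⁻¹' Z) :=
    TCPlus.excLetter_birth₀ k O θ hθ q Y σ' hX'reg j t hsq C Z hZ hCj hCfl hCreg hfr hoff hτ₃ j₃ t₃ hsq₃ hcomm₃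
  exact ⟨X₃, τ₃ ≫ σ', _, j₃, t₃, hCh₃, hX₃i, hX₃n, hX₃r, hX₃dom, hsq₃, rfl, isClosed_closure, hirr₃, hF₃i, hLs₃, hE₃⟩

end Summit.ResolutionOfSingularities.ResolutionOfSingularities.Cruxes.EquisingularLiftNat.Sections

end
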